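import Literature.MathematicalPhysics.QuantumFieldTheory.Balaban1983to89.B12LieCentreClosedSubgroup
import Literature.MathematicalPhysics.QuantumFieldTheory.Balaban1983to89.B12LieComplexification
import Literature.MathematicalPhysics.QuantumLattice.GaugeGroupsProofs

/-!
# `Balaban1983to89.B12SpecialUnitaryClosedSubgroup` — [Balaban1987RG1] §0 pp. 251–252 «G … a Lie subgroup of … U(N)» AT THE
# CELL'S GAUGE GROUP `G = SU(N)`: `SU(N)` as a CLOSED CONNECTED subgroup of `U(N)`, its log-chart Lie algebra 𝐠 `= 𝔰𝔲(N)`,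
# 𝐠ᶜ `= 𝔰𝔩(N, ℂ)`, and its centre `Z(SU(N))` FINITE — the hypotheses of the cell's «every closed (connected) G ≤ U(N)» files
# DISCHARGED at `SU(N)`

statement-level skeleton of published theorems with citation tags; proofs where landed; nothing here is a claim about the Yang–Mills mass gap

Unit `lit-balaban-p24` gen 10 (Phase-2 proof seat, free-target protocol G.5-34(d), own Lie lane; file 6, glue).  The Lie-lane files of
gens 8–10 (`LogChartClosedSubgroup`, `HaarSmallBallClosedSubgroup`, `B16ZLowerCompactGroup`, `B12LieComplexification`,
`T4AdjointCovarianceClosedSubgroup`, `B12FaddeevPopov016ClosedSubgroup`, `B12LieCentreClosedSubgroup`, …) take print's group as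
`G : Subgroup (Matrix.unitaryGroup n ℂ)` with `IsClosed ↑G` (and `IsConnected ↑G` where needed).  This file presents the cell's
gauge group `SU(N)` in that format, hypothesis-free.  SKELETON rows served (support, NO head change): B12.Def§0 (owner r09/r20).

CITATION HEADER.  T. Bałaban, Commun. Math. Phys. **109** (1987) 249–301 [Balaban1987RG1] §0 pp. 251–252: *«G is … a Lie subgroup of
a group of complex unitary matrices, for example G ⊂ U(N)»*, *«A Lie algebra of the group G is denoted by 𝐠»*, *«𝐠ᶜ is the
complexification of the real Lie algebra 𝐠»*, p. 259 *«G = SU(2)»*.  [Hall2015] B. C. Hall, GTM 222 — the classical facts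
used: `SU(n)` is closed (Def. 1.4, «matrix Lie group»), connected (**Prop. 1.13** *«The groups U(n) and SU(n) are connected,
for all n ≥ 1»*; tree: `QuantumLattice.connectedSpace_specialUnitaryGroup`, [BrockerTomDieck1985] IV (3.1)), its Lie algebra is
`𝔰𝔲(n)` (**Prop. 3.24**; tree: gen 8 `LogChartClosedSubgroup.mem_su_iff_forall_exp_mem_specialUnitaryGroup`), `𝔰𝔲(n)_ℂ ≅
𝔰𝔩(n; ℂ)` (**Prop. 3.38 / (3.17)**; tree: gen 10 `B12LieComplexification.complexify_su_eq_sl`), and `𝔰𝔲(n)` has trivial centre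
(tree: gen 7 `CompactKillingForm.eq_zero_of_mem_su_of_forall_commute`, `center_su_eq_bot`); [BrockerTomDieck1985] V (3.14) (finite
centre; tree: gen 10 `B12LieCentreClosedSubgroup.center_finite_of_lieCentre_trivial`); [Sepanski2007] M. R. Sepanski, *Compact Lie
Groups*, GTM 235, **Exercise 1.7 (a)** *«Z(U(n)) ≅ S¹ and Z(SU(n)) ≅ ℤ/nℤ for n ≥ 2»*, Exercise 2.19 (centres by Schur's lemma).

WHAT THIS MODULE PROVES (one definition `specialUnitarySubgroup`, theorems; no named fact, no `sorry`; axioms standard).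
* §1 `specialUnitarySubgroup n : Subgroup (Matrix.unitaryGroup n ℂ)` (= `{u | det u = 1}`), `mem_specialUnitarySubgroup_iff`,
  `coe_mem_specialUnitaryGroup_iff` / `image_val_specialUnitarySubgroup` (its image in `M_N(ℂ)` is Mathlib's
  `Matrix.specialUnitaryGroup n ℂ`), **`isClosed_specialUnitarySubgroup`**, **`isConnected_specialUnitarySubgroup`**.
* §2 its log-chart Lie algebra is `𝔰𝔲(N)` (`mem_lie_specialUnitarySubgroup_iff`, `lieSubalgebra_specialUnitarySubgroup` `= su n`),
  its complexification is `𝔰𝔩(N, ℂ)` (`lieC_specialUnitarySubgroup`), both semisimple (instances by rewriting to gen 7 ∕ gen 10).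
* §3 **`Z(SU(N))` IS FINITE** (`center_specialUnitarySubgroup_finite`: gen 10's (3.14) `⇒` with gen 7's `𝔷(𝔰𝔲(N)) = 0`) — the
  group-level reading of «G = SU(N) is semisimple».
* §4 (v1.1) **SCHUR FOR THE STANDARD REPRESENTATION**: a matrix commuting with `𝔰𝔲(N)` (`mem_range_scalar_of_forall_commute_su`),
  or with `SU(N)` (`mem_range_scalar_of_forall_commute`, via gen 10's `forall_commute_lie_of_forall_commute`), is scalar; hence
  **`Z(SU(N))` = the scalar matrices `ω·1` in `SU(N)`** (`mem_center_specialUnitarySubgroup_iff`), with `ω^N = 1`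
  (`pow_card_eq_one_of_coe_eq_scalar`), and **`|Z(SU(N))| = N`** (`card_center_specialUnitarySubgroup`: bijection `ζ ↦ ζ·1` with the
  `N`-th roots of unity, Mathlib `Complex.card_rootsOfUnity`) — [Sepanski2007] Exercise 1.7 (a) «Z(SU(n)) ≅ ℤ/nℤ».
HONEST SCOPE.  The GROUP isomorphism `Z(SU(N)) ≅ ℤ/N` (cyclicity) is not spelled out — only the bijection with `μ_N(ℂ)` (a private
map) and the count; `N ≥ 1` (`[Nonempty n]`) where the tree's inputs need it.  Nothing of the paper's analysis is touched; row heads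
unchanged.

v1.1 (append-only): §4 added; v1.0 declarations unchanged.
-/

noncomputable section

open NormedSpace Set

attribute [local instance 100] LieRing.ofAssociativeRing

namespace Literature.MathematicalPhysics.QuantumFieldTheory.Balaban1983to89.B12SpecialUnitaryClosedSubgroup

open Literature.MathematicalPhysics.QuantumLattice (connectedSpace_specialUnitaryGroup)
open Literature.Algebra.Lie.CompactKillingForm (su mem_su_iff eq_zero_of_mem_su_of_forall_commute)
open LogChartClosedSubgroup (unitarySubgroupLogChart mem_unitarySubgroupLogChart_lie_iff mem_su_iff_forall_exp_mem_specialUnitaryGroup)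
open B12LieCentreClosedSubgroup (center_finite_of_lieCentre_trivial forall_commute_lie_of_forall_commute mem_center_iff_forall)
open B12LieComplexification (lieSubalgebra lieC mem_lieSubalgebra_iff_mem_logChart_lie complexify_su_eq_sl isSemisimple_complexify_su)
open LieAlgebra.SpecialLinear (sl)
open scoped Matrix.Norms.L2Operator

variable (n : Type*) [Fintype n] [DecidableEq n]

/-! ## §1 `SU(N) ≤ U(N)`: a closed connected subgroup -/

/-- **`SU(N)` as a subgroup of `U(N)`**: the unitaries of determinant `1`. [cite: Hall2015, Def. 1.4; Balaban1987RG1, §0 p.252] -/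
def specialUnitarySubgroup : Subgroup (Matrix.unitaryGroup n ℂ) where
  carrier := {u | (u : Matrix n n ℂ).det = 1}
  mul_mem' {a b} ha hb := by
    simp only [mem_setOf_eq] at ha hb ⊢
    rw [Submonoid.coe_mul, Matrix.det_mul, ha, hb, mul_one]
  one_mem' := by simp
  inv_mem' {a} ha := by
    simp only [mem_setOf_eq] at ha ⊢
    rw [Matrix.UnitaryGroup.inv_val, Matrix.star_eq_conjTranspose, Matrix.det_conjTranspose, ha, star_one]

variable {n} in
/-- Membership: `det u = 1`. [cite: Hall2015, Def. 1.4] -/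
theorem mem_specialUnitarySubgroup_iff {u : Matrix.unitaryGroup n ℂ} :
    u ∈ specialUnitarySubgroup n ↔ (u : Matrix n n ℂ).det = 1 := Iff.rfl

variable {n} in
/-- `SU(N) ≤ U(N)` read in `M_N(ℂ)` is Mathlib's `Matrix.specialUnitaryGroup n ℂ`. [cite: Hall2015, Def. 1.4] -/
theorem coe_mem_specialUnitaryGroup_iff {u : Matrix.unitaryGroup n ℂ} :
    (u : Matrix n n ℂ) ∈ Matrix.specialUnitaryGroup n ℂ ↔ u ∈ specialUnitarySubgroup n := by
  rw [Matrix.mem_specialUnitaryGroup_iff, mem_specialUnitarySubgroup_iff]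
  exact ⟨fun h => h.2, fun h => ⟨u.2, h⟩⟩

/-- The image of `SU(N) ≤ U(N)` in `M_N(ℂ)` is `Matrix.specialUnitaryGroup n ℂ`. [cite: Hall2015, Def. 1.4] -/
theorem image_val_specialUnitarySubgroup :
    (Subtype.val '' (specialUnitarySubgroup n : Set (Matrix.unitaryGroup n ℂ)) : Set (Matrix n n ℂ)) =
      (Matrix.specialUnitaryGroup n ℂ : Set (Matrix n n ℂ)) := by
  ext A
  constructor
  · rintro ⟨u, hu, rfl⟩
    exact coe_mem_specialUnitaryGroup_iff.2 hu
  · intro hA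
    exact ⟨⟨A, (Matrix.mem_specialUnitaryGroup_iff.1 hA).1⟩, coe_mem_specialUnitaryGroup_iff.1 hA, rfl⟩

/-- **`SU(N)` is closed in `U(N)`** (`det` is continuous). [cite: Hall2015, Def. 1.4] -/
theorem isClosed_specialUnitarySubgroup : IsClosed (specialUnitarySubgroup n : Set (Matrix.unitaryGroup n ℂ)) :=
  isClosed_eq (continuous_subtype_val.matrix_det) continuous_const

/-- **`SU(N)` is connected** (as a subset of `U(N)`; the tree's `connectedSpace_specialUnitaryGroup`, [BrockerTomDieck1985] IV (3.1)).
[cite: Hall2015, Prop. 1.13; BrockerTomDieck1985, IV (3.1)] -/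
theorem isConnected_specialUnitarySubgroup [Nonempty n] :
    IsConnected (specialUnitarySubgroup n : Set (Matrix.unitaryGroup n ℂ)) := by
  haveI := connectedSpace_specialUnitaryGroup (n := n)
  have hf : Continuous fun g : Matrix.specialUnitaryGroup n ℂ =>
      (⟨(g : Matrix n n ℂ), (Matrix.mem_specialUnitaryGroup_iff.1 g.2).1⟩ : Matrix.unitaryGroup n ℂ) :=
    continuous_subtype_val.subtype_mk _
  convert isConnected_range hf using 1
  ext u
  constructor
  · intro hu
    exact ⟨⟨(u : Matrix n n ℂ), coe_mem_specialUnitaryGroup_iff.2 hu⟩, Subtype.ext rfl⟩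
  · rintro ⟨g, rfl⟩
    exact (Matrix.mem_specialUnitaryGroup_iff.1 g.2).2

/-! ## §2 Its Lie algebra is `𝔰𝔲(N)`, its complexification `𝔰𝔩(N, ℂ)` -/

variable {n} in
/-- **The log-chart Lie algebra of `SU(N) ≤ U(N)` is `𝔰𝔲(N)`** (Hall Prop. 3.24 through gen 8's
`mem_su_iff_forall_exp_mem_specialUnitaryGroup`). [cite: Hall2015, Prop. 3.24; Balaban1987RG1, §0 p.252] -/
theorem mem_lie_specialUnitarySubgroup_iff [Nonempty n] {X : Matrix n n ℂ} :
    X ∈ (unitarySubgroupLogChart (specialUnitarySubgroup n) (isClosed_specialUnitarySubgroup n)).lie ↔ X ∈ su n := by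
  rw [mem_unitarySubgroupLogChart_lie_iff, image_val_specialUnitarySubgroup, mem_su_iff, ← Matrix.star_eq_conjTranspose,
    mem_su_iff_forall_exp_mem_specialUnitaryGroup]
  rfl

/-- **𝐠(SU(N)) = 𝔰𝔲(N)** as a real Lie subalgebra of `M_N(ℂ)` (gen 10's packaging `B12LieComplexification.lieSubalgebra`).
[cite: Hall2015, Prop. 3.24; Balaban1987RG1, §0 p.252] -/
theorem lieSubalgebra_specialUnitarySubgroup [Nonempty n] :
    lieSubalgebra (specialUnitarySubgroup n) (isClosed_specialUnitarySubgroup n) = su n := by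
  ext X
  rw [mem_lieSubalgebra_iff_mem_logChart_lie, mem_lie_specialUnitarySubgroup_iff]

/-- **𝐠ᶜ(SU(N)) = 𝔰𝔩(N, ℂ)** (gen 10's `lieC` and `complexify_su_eq_sl`). [cite: Hall2015, Prop. 3.38; Balaban1987RG1, §0 p.252] -/
theorem lieC_specialUnitarySubgroup [Nonempty n] :
    lieC (specialUnitarySubgroup n) (isClosed_specialUnitarySubgroup n) = sl n ℂ := by
  rw [lieC, lieSubalgebra_specialUnitarySubgroup, complexify_su_eq_sl]

/-- 𝐠(SU(N)) is semisimple (gen 7's `instIsSemisimpleSu`, transported). [cite: Hall2015, Example 7.3; BrockerTomDieck1985, V (5.13)] -/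
instance isSemisimple_lieSubalgebra_specialUnitarySubgroup [Nonempty n] :
    LieAlgebra.IsSemisimple ℝ (lieSubalgebra (specialUnitarySubgroup n) (isClosed_specialUnitarySubgroup n)) := by
  rw [lieSubalgebra_specialUnitarySubgroup]
  infer_instance

/-- 𝐠ᶜ(SU(N)) is semisimple (gen 10's `isSemisimple_complexify_su`, transported). [cite: Varadarajan1984, §3.9 Cor. 3.9.4] -/
instance isSemisimple_lieC_specialUnitarySubgroup [Nonempty n] :
    LieAlgebra.IsSemisimple ℂ (lieC (specialUnitarySubgroup n) (isClosed_specialUnitarySubgroup n)) := by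
  rw [lieC_specialUnitarySubgroup, ← complexify_su_eq_sl]
  exact isSemisimple_complexify_su

/-! ## §3 The centre of `SU(N)` is finite -/

/-- **`Z(SU(N))` IS FINITE** — [BrockerTomDieck1985] V (3.14) `⇒` (gen 10 `center_finite_of_lieCentre_trivial`, any closed
`G ≤ U(N)`) with `𝔷(𝔰𝔲(N)) = 0` (gen 7 `eq_zero_of_mem_su_of_forall_commute`): the group-level reading of «G = SU(N) is
semisimple». [cite: BrockerTomDieck1985, V (3.14); Balaban1987RG1, §0 pp.251–252] -/
theorem center_specialUnitarySubgroup_finite [Nonempty n] :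
    (Subgroup.center (specialUnitarySubgroup n) : Set (specialUnitarySubgroup n)).Finite :=
  center_finite_of_lieCentre_trivial (specialUnitarySubgroup n) (isClosed_specialUnitarySubgroup n) fun _ hX hc =>
    eq_zero_of_mem_su_of_forall_commute (mem_lie_specialUnitarySubgroup_iff.1 hX) fun Y hY =>
      hc Y (mem_lie_specialUnitarySubgroup_iff.2 hY)

/-! ## §4 (v1.1) Schur for the standard representation: the centre of `SU(N)` is scalar, `Z(SU(N)) = {ω·1 | ω^N = 1}` -/

/-- **A matrix commuting with `𝔰𝔲(N)` is scalar**: with `i ≠ j` it commutes with `E_{ij} − E_{ji}`, `i(E_{ij} + E_{ji}) ∈ 𝔰𝔲(N)`,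
hence with the matrix unit `E_{ij}`; Mathlib's `Matrix.mem_range_scalar_of_commute_single` (the argument of gen 7's
`CompactKillingForm.eq_zero_of_mem_su_of_forall_commute`, without the hypothesis `X ∈ 𝔰𝔲(N)`). [cite: Sepanski2007, Exercise 2.19; Hall2015, Example 7.3] -/
theorem mem_range_scalar_of_forall_commute_su {X : Matrix n n ℂ} (h : ∀ Y ∈ su n, X * Y = Y * X) :
    X ∈ Set.range (Matrix.scalar n) := by
  refine Matrix.mem_range_scalar_of_commute_single fun i j hij => ?_
  have hY₁ : Matrix.single i j (1 : ℂ) - Matrix.single j i 1 ∈ su n := by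
    refine ⟨?_, ?_⟩
    · rw [Matrix.conjTranspose_sub, Matrix.conjTranspose_single, Matrix.conjTranspose_single, star_one, neg_sub]
    · rw [Matrix.trace_sub, Matrix.trace_single_eq_of_ne i j 1 hij, Matrix.trace_single_eq_of_ne j i 1 hij.symm, sub_zero]
  have hY₂ : Complex.I • (Matrix.single i j (1 : ℂ) + Matrix.single j i 1) ∈ su n := by
    refine ⟨?_, ?_⟩
    · rw [Matrix.conjTranspose_smul, Matrix.conjTranspose_add, Matrix.conjTranspose_single, Matrix.conjTranspose_single,
        star_one, Complex.star_def, Complex.conj_I, neg_smul, add_comm]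
    · rw [Matrix.trace_smul, Matrix.trace_add, Matrix.trace_single_eq_of_ne i j 1 hij,
        Matrix.trace_single_eq_of_ne j i 1 hij.symm, add_zero, smul_zero]
  have c₁ : Commute (Matrix.single i j (1 : ℂ) - Matrix.single j i 1) X := (h _ hY₁).symm
  have c₂ : Commute (Complex.I • (Matrix.single i j (1 : ℂ) + Matrix.single j i 1)) X := (h _ hY₂).symm
  have c₃ : Commute ((2⁻¹ : ℂ) • ((Matrix.single i j (1 : ℂ) - Matrix.single j i 1) +
      (-Complex.I) • (Complex.I • (Matrix.single i j (1 : ℂ) + Matrix.single j i 1)))) X :=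
    (c₁.add_left (c₂.smul_left _)).smul_left _
  have hE : (2⁻¹ : ℂ) • ((Matrix.single i j (1 : ℂ) - Matrix.single j i 1) +
      (-Complex.I) • (Complex.I • (Matrix.single i j (1 : ℂ) + Matrix.single j i 1))) = Matrix.single i j 1 := by
    rw [smul_smul, neg_mul, Complex.I_mul_I, neg_neg, one_smul, sub_add_add_cancel, ← two_smul ℂ, smul_smul,
      inv_mul_cancel₀ two_ne_zero, one_smul]
  rwa [hE] at c₃

/-- **SCHUR FOR THE STANDARD REPRESENTATION OF `SU(N)`: a matrix commuting with every element of `SU(N)` is scalar**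
(`N ≥ 1`; it commutes with 𝐠 = 𝔰𝔲(N) by gen 10's `forall_commute_lie_of_forall_commute`). [cite: Sepanski2007, Exercise 2.19] -/
theorem mem_range_scalar_of_forall_commute [Nonempty n] {X : Matrix n n ℂ}
    (h : ∀ g ∈ specialUnitarySubgroup n, (g : Matrix n n ℂ) * X = X * (g : Matrix n n ℂ)) :
    X ∈ Set.range (Matrix.scalar n) :=
  mem_range_scalar_of_forall_commute_su n fun Y hY =>
    forall_commute_lie_of_forall_commute (specialUnitarySubgroup n) (isClosed_specialUnitarySubgroup n) h Y
      (mem_lie_specialUnitarySubgroup_iff.2 hY)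

/-- **THE CENTRE OF `SU(N)` IS SCALAR**: `g ∈ Z(SU(N))` iff `g = ω·1` for some `ω ∈ ℂ` (then `ω^N = det g = 1`:
`pow_card_eq_one_of_coe_eq_scalar`). [cite: Sepanski2007, Exercise 1.7 (a)] -/
theorem mem_center_specialUnitarySubgroup_iff [Nonempty n] {g : specialUnitarySubgroup n} :
    g ∈ Subgroup.center (specialUnitarySubgroup n) ↔
      ((g : Matrix.unitaryGroup n ℂ) : Matrix n n ℂ) ∈ Set.range (Matrix.scalar n) := by
  constructor
  · intro hg
    exact mem_range_scalar_of_forall_commute n fun v hv =>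
      congrArg Subtype.val ((mem_center_iff_forall (specialUnitarySubgroup n)).1 hg v hv)
  · rintro ⟨ω, hω⟩
    refine (mem_center_iff_forall (specialUnitarySubgroup n)).2 fun v _ => Subtype.ext ?_
    show (v : Matrix n n ℂ) * ((g : Matrix.unitaryGroup n ℂ) : Matrix n n ℂ) =
      ((g : Matrix.unitaryGroup n ℂ) : Matrix n n ℂ) * (v : Matrix n n ℂ)
    rw [← hω]
    exact (Matrix.scalar_commute ω (fun _ => Commute.all _ _) _).symm.eq

/-- For `g = ω·1 ∈ SU(N)`: `ω^N = 1` (`det g = 1`). [cite: Sepanski2007, Exercise 1.7 (a)] -/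
theorem pow_card_eq_one_of_coe_eq_scalar {g : specialUnitarySubgroup n} {ω : ℂ}
    (hω : Matrix.scalar n ω = ((g : Matrix.unitaryGroup n ℂ) : Matrix n n ℂ)) : ω ^ Fintype.card n = 1 := by
  have h := mem_specialUnitarySubgroup_iff.1 g.2
  rwa [← hω, Matrix.scalar_apply, Matrix.det_diagonal, Finset.prod_const, Finset.card_univ] at h

/-- A unimodular scalar matrix is unitary. [folklore] -/
private theorem scalar_mem_unitaryGroup {z : ℂ} (hz : ‖z‖ = 1) : Matrix.scalar n z ∈ Matrix.unitaryGroup n ℂ := by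
  rw [Matrix.mem_unitaryGroup_iff, Matrix.scalar_apply, Matrix.star_eq_conjTranspose, Matrix.diagonal_conjTranspose,
    Matrix.diagonal_mul_diagonal, ← Matrix.diagonal_one]
  congr 1
  funext i
  rw [Pi.star_apply, Complex.star_def, Complex.mul_conj, Complex.normSq_eq_norm_sq, hz, one_pow, Complex.ofReal_one]

/-- The central element `ζ·1 ∈ Z(SU(N))` attached to an `N`-th root of unity `ζ`. [cite: Sepanski2007, Exercise 1.7 (a)] -/
private def centerOfRoot [Nonempty n] (ζ : rootsOfUnity (Fintype.card n) ℂ) :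
    Subgroup.center (specialUnitarySubgroup n) :=
  have hpow : (((ζ : ℂˣ) : ℂ)) ^ Fintype.card n = 1 := (mem_rootsOfUnity' _ _).1 ζ.2
  have hU : Matrix.scalar n ((ζ : ℂˣ) : ℂ) ∈ Matrix.unitaryGroup n ℂ :=
    scalar_mem_unitaryGroup n (Complex.norm_eq_one_of_pow_eq_one hpow Fintype.card_ne_zero)
  have hSU : (⟨_, hU⟩ : Matrix.unitaryGroup n ℂ) ∈ specialUnitarySubgroup n := by
    rw [mem_specialUnitarySubgroup_iff]
    show (Matrix.scalar n ((ζ : ℂˣ) : ℂ)).det = 1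
    rw [Matrix.scalar_apply, Matrix.det_diagonal, Finset.prod_const, Finset.card_univ, hpow]
  ⟨⟨_, hSU⟩, (mem_center_specialUnitarySubgroup_iff n).2 ⟨_, rfl⟩⟩

/-- **`Z(SU(N)) ≅ ℤ/N` as a COUNT: the centre of `SU(N)` has exactly `N` elements** (it is in bijection with the `N`-th roots of
unity `ζ ↦ ζ·1`). [cite: Sepanski2007, Exercise 1.7 (a)] -/
theorem card_center_specialUnitarySubgroup [Nonempty n] :
    Nat.card (Subgroup.center (specialUnitarySubgroup n)) = Fintype.card n := by
  haveI : NeZero (Fintype.card n) := ⟨Fintype.card_ne_zero⟩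
  have hinj : Function.Injective (centerOfRoot n) := by
    intro ζ₁ ζ₂ h
    have h' := congrArg (fun c : Subgroup.center (specialUnitarySubgroup n) =>
      (((c : specialUnitarySubgroup n) : Matrix.unitaryGroup n ℂ) : Matrix n n ℂ)) h
    exact Subtype.ext (Units.ext (Matrix.scalar_inj.1 h'))
  have hsurj : Function.Surjective (centerOfRoot n) := by
    intro c
    obtain ⟨ω, hω⟩ := (mem_center_specialUnitarySubgroup_iff n).1 c.2
    refine ⟨rootsOfUnity.mkOfPowEq ω (pow_card_eq_one_of_coe_eq_scalar n hω), ?_⟩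
    apply Subtype.ext; apply Subtype.ext; apply Subtype.ext
    exact hω
  rw [← Nat.card_congr (Equiv.ofBijective _ ⟨hinj, hsurj⟩), Complex.card_rootsOfUnity]

end Literature.MathematicalPhysics.QuantumFieldTheory.Balaban1983to89.B12SpecialUnitaryClosedSubgroup

end
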